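import Literature.NumberTheory.Irrationality.RhinViola2001.OmegaSets
import Literature.NumberTheory.Irrationality.RhinViola1996.IrrationalityMeasureLemma
import HarnessLib

/-!
# Rhin–Viola 2001, Theorem 5.1: "If `c₀ > c₂`, then `μ(ζ(3)) ≤ (c₀ + c₁)/(c₀ − c₂)`" — the deduction as printed

Topic `Literature/NumberTheory/Irrationality/RhinViola2001`. Typed-and-PROVED (no definition, no named fact; cell
`zeta5-irr`, seat zi-lit g17) from G. Rhin, C. Viola, *The group structure for ζ(3)*, Acta Arith. **97** (2001) 269–293
[RhinViola2001], §5 pp. 290–292 (held text `paper:doi-10-4064-aa97-3-6`, p0022–p0024 read on the page).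

The source (p. 292): "Define `c₀ = −log f(x₀, y₀, z₀)`, `c₁ = log|f(x₁, y₁, z₁)|`, `c₂ = M + N + Q − (∫_{Ω_E} dψ + ∫_{Ω′_E} dψ)`.
From (5.14), (5.18), (5.19) and Lemma 4.3 of [4] we obtain the following theorem, similar to Theorem 5.1 of [4].
**Theorem 5.1.** If `c₀ > c₂`, then `μ(ζ(3)) ≤ (c₀ + c₁)/(c₀ − c₂)`." Here (p. 290) "`D_n I_n = D_n a_n + 2D_n b_n ζ(3) ∈
ℤ + 2ℤζ(3)`, and in order to get an irrationality measure of `ζ(3)` we can apply Lemma 4.3 of [4] to `D_n I_n`", with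
(5.14) `lim (1/n) log D_n = M + N + Q − (∫_{Ω_E} dψ + ∫_{Ω′_E} dψ)` [= `c₂`], (5.18) `lim (1/n) log I_n = log f(x₀, y₀, z₀)`
[= `−c₀`], (5.19) `limsup (1/n) log|b_n| ≤ log|f(x₁, y₁, z₁)|` [= `c₁`]; [4] = Rhin–Viola 1996, whose Lemma 4.3 is the
tree's `RhinViola1996.lemma43`.

THIS file proves exactly that deduction for the record parameters `rvChoice` (`M, N, Q = 19, 18, 17`): from ANY
decomposition `I_n = a_n + 2b_nζ(3)` (`a_n ∈ ℚ`, `b_n ∈ ℤ`, `n ≥ 1`; it exists and is unique, `Theorem21.theorem21_scale`,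
`LevelFour.rat_part_unique`), the three printed limit statements (5.14) (for the tree's `D_n = Section5.bigD n` of
`OmegaSets.lean`), (5.18), (5.19) TAKEN AS HYPOTHESES with values `c₂`, `−c₀`, `c₁`, and `c₀ > c₂`, it follows that
`μ(ζ(3)) ≤ (c₀ + c₁)/(c₀ − c₂)` (`theorem51`, in the tree's rendering `Hata1993.HasIrrationalityMeasure`; `LiouvilleWith`
form `theorem51_not_liouvilleWith`). The integrality inputs are the tree's theorems: `D_n a_n ∈ ℤ` (`Section5.bigD_mul_a`,
from `Δ_n Δ′_n ∣ A_n`), `D_n ∈ ℕ`.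

Deviation, named: Lemma 4.3 of [4] needs "positive numbers `R` and `S`"; `R = c₀ − c₂ > 0` is the printed hypothesis,
and `S = c₁ + c₂ > 0` is implicit in the source (for the record data `c₁ + c₂ = 78.28…`); it is an explicit hypothesis
here. The limsup (5.19) is typed in the unfolded form "`(1/n) log|b_n| ≤ c₁ + δ` for all large `n`, every `δ > 0`".

What is NOT here (the remaining inputs of (1.4) `μ(ζ(3)) < 5.513891`, all analytic/numerical): (5.14) itself (prime
number theorem for the sets `Ω`, `∫ dψ = 18.04470204…, 6.14298325…`), (5.16)–(5.18) (`c₀ = 47.15472079…`), and the value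
`c₁ = 48.46940964…` in (5.19) (the tree has the `c₁`-leg inequality `Theorem31.record_abs_b_le_sharp`).

HONEST FRAMING (cells pub-zeta5 / zeta5-irr): the printed deduction step of a 2001 record, as printed; no measure of
`ζ(3)` is asserted unconditionally here; records in print unmoved; nothing about `ζ(5)`.
-/

noncomputable section

namespace Literature.NumberTheory.Irrationality.RhinViola2001

namespace Section5

open Filter Real Topology
open Literature.NumberTheory.Transcendental (zetaValue)
open Literature.NumberTheory.Irrationality.Hata1993 (HasIrrationalityMeasure)

/-- `D_n ≥ 1` ("whence `D_n ∈ ℤ`", a quotient of `d_{Mn} d_{Nn} d_{Qn} > 0`). [cite: RhinViola2001, §5 p. 290 (definition of `D_n`)] -/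
theorem bigD_pos (n : ℕ) : 0 < bigD n := by
  have h := bigD_mul_Delta n
  have hd : 0 < d ((n : ℤ) * 19) * d ((n : ℤ) * 18) * d ((n : ℤ) * 17) := by
    unfold d; exact Nat.mul_pos (Nat.mul_pos (Nat.lcmUpto_pos _) (Nat.lcmUpto_pos _)) (Nat.lcmUpto_pos _)
  rcases Nat.eq_zero_or_pos (bigD n) with h0 | h0
  · rw [h0, zero_mul] at h; omega
  · exact h0

/-- For `n ≥ 1` and any decomposition `I_n = a_n + 2b_nζ(3)`, `D_n a_n` is an integer (`= A_n/(Δ_n Δ′_n)`).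
[cite: RhinViola2001, §5 p. 290 ("`D_n a_n = A_n/(Δ_n Δ′_n) ∈ ℤ`")] -/
theorem exists_int_bigD_mul_a {n : ℕ} (hn : 1 ≤ n) {a : ℚ} {b : ℤ}
    (hab : I (rvChoice.scale n) = a + 2 * b * zetaValue 3) : ∃ A' : ℤ, (bigD n : ℚ) * a = A' := by
  obtain ⟨a₀, b₀, h₀, A, hA, -⟩ := record_decomposition hn
  have ha : a = a₀ := LevelFour.rat_part_unique hab h₀
  subst ha
  obtain ⟨A', -, hA'⟩ := bigD_mul_a hn hab hA
  exact ⟨A', hA'⟩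

/-- **Theorem 5.1** (the printed deduction, record parameters `h = 16, …, s = 13`): let `I_n = a_n + 2b_nζ(3)` (`n ≥ 1`,
`a_n ∈ ℚ`, `b_n ∈ ℤ`) and suppose (5.14) `lim (1/n) log D_n = c₂`, (5.18) `lim (1/n) log I_n = −c₀`,
(5.19) `limsup (1/n) log|b_n| ≤ c₁` (typed: `(1/n) log|b_n| ≤ c₁ + δ` for all large `n`, every `δ > 0`), with `c₁ + c₂ > 0`.
"If `c₀ > c₂`, then `μ(ζ(3)) ≤ (c₀ + c₁)/(c₀ − c₂)`" — by Lemma 4.3 of [4] (`RhinViola1996.lemma43`) applied to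
`D_n I_n = D_n a_n + 2D_n b_n ζ(3)`. [cite: RhinViola2001, Theorem 5.1 (p. 292) with p. 290 and (5.14), (5.18), (5.19)] -/
theorem theorem51 {c₀ c₁ c₂ : ℝ} (a : ℕ → ℚ) (b : ℕ → ℤ)
    (hab : ∀ n : ℕ, 1 ≤ n → I (rvChoice.scale n) = a n + 2 * b n * zetaValue 3)
    (h514 : Tendsto (fun n : ℕ => Real.log (bigD n) / n) atTop (𝓝 c₂))
    (h518 : Tendsto (fun n : ℕ => Real.log (I (rvChoice.scale n)) / n) atTop (𝓝 (-c₀)))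
    (h519 : ∀ δ : ℝ, 0 < δ → ∀ᶠ n : ℕ in atTop, Real.log |(b n : ℝ)| / n ≤ c₁ + δ)
    (hS : 0 < c₁ + c₂) (hc : c₂ < c₀) :
    HasIrrationalityMeasure (zetaValue 3) ((c₀ + c₁) / (c₀ - c₂)) := by
  -- the integer sequences `r_n = D_n a_n`, `s_n = −2 D_n b_n`
  set r : ℕ → ℤ := fun n => ⌊(bigD n : ℚ) * a n⌋ with hr_def
  set s : ℕ → ℤ := fun n => -(2 * (bigD n : ℤ) * b n) with hs_def
  have hr : ∀ n : ℕ, 1 ≤ n → ((r n : ℚ) : ℝ) = (bigD n : ℝ) * (a n : ℝ) := by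
    intro n hn
    obtain ⟨A', hA'⟩ := exists_int_bigD_mul_a hn (hab n hn)
    have h1 : r n = A' := by simp only [hr_def]; rw [hA', Int.floor_intCast]
    have h2 : ((bigD n : ℚ) * a n : ℚ) = (r n : ℚ) := by rw [h1]; exact hA'
    have h3 := congrArg (fun x : ℚ => (x : ℝ)) h2
    simp only [Rat.cast_mul, Rat.cast_natCast, Rat.cast_intCast] at h3
    push_cast
    exact h3.symm
  -- `r_n − s_n ζ(3) = D_n I_n`
  have herr_eq : ∀ n : ℕ, 1 ≤ n → (r n : ℝ) - s n * zetaValue 3 = bigD n * I (rvChoice.scale n) := by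
    intro n hn
    have h1 : (r n : ℝ) = (bigD n : ℝ) * (a n : ℝ) := by
      have := hr n hn; push_cast at this; exact this
    rw [h1, hab n hn]
    simp only [hs_def]; push_cast; ring
  -- `c₂ ≥ 0`, hence `c₀ > 0`
  have hD1 : ∀ n : ℕ, (1 : ℝ) ≤ bigD n := fun n => by exact_mod_cast bigD_pos n
  have hc₂ : 0 ≤ c₂ :=
    ge_of_tendsto' h514 fun n => div_nonneg (Real.log_nonneg (hD1 n)) (Nat.cast_nonneg n)
  have hc₀ : 0 < c₀ := lt_of_le_of_lt hc₂ hc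
  -- (a) the error rate: `(1/n) log|r_n − s_n ζ(3)| = (1/n) log D_n + (1/n) log I_n → c₂ − c₀`
  have hI_ne : ∀ᶠ n : ℕ in atTop, I (rvChoice.scale n) ≠ 0 := by
    have hev := h518.eventually (eventually_lt_nhds (by linarith : -c₀ < -c₀ / 2))
    filter_upwards [hev] with n hn
    intro h0
    rw [h0, Real.log_zero, zero_div] at hn
    linarith
  have herr : Tendsto (fun n : ℕ => Real.log |(r n : ℝ) - s n * zetaValue 3| / n) atTop
      (𝓝 (-(c₀ - c₂))) := by
    have hsum : Tendsto (fun n : ℕ => Real.log (bigD n) / n + Real.log (I (rvChoice.scale n)) / n) atTop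
        (𝓝 (c₂ + -c₀)) := h514.add h518
    rw [show -(c₀ - c₂) = c₂ + -c₀ by ring]
    refine hsum.congr' ?_
    filter_upwards [hI_ne, eventually_ge_atTop 1] with n hIn hn
    rw [herr_eq n hn, abs_mul, abs_of_pos (by linarith [hD1 n] : (0 : ℝ) < bigD n), Real.log_mul
      (by linarith [hD1 n]) (abs_ne_zero.2 hIn), Real.log_abs, add_div]
  -- (b) the coefficient rate: `(1/n) log|s_n| ≤ c₁ + c₂ + δ` for large `n`
  have hs : ∀ δ : ℝ, 0 < δ → ∀ᶠ n : ℕ in atTop, Real.log |(s n : ℝ)| / n ≤ c₁ + c₂ + δ := by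
    intro δ hδ
    have h2 : ∀ᶠ n : ℕ in atTop, Real.log 2 / n ≤ δ / 3 :=
      (tendsto_const_div_atTop_nhds_zero_nat (Real.log 2)).eventually (eventually_le_nhds (by positivity))
    have hD : ∀ᶠ n : ℕ in atTop, Real.log (bigD n) / n ≤ c₂ + δ / 3 :=
      h514.eventually (eventually_le_nhds (by linarith))
    filter_upwards [h2, hD, h519 (δ / 3) (by positivity), eventually_ge_atTop 1] with n h2n hDn hbn hn
    have hn0 : (0 : ℝ) < n := by exact_mod_cast hn
    by_cases hb0 : b n = 0
    · have : s n = 0 := by simp [hs_def, hb0]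
      rw [this, Int.cast_zero, abs_zero, Real.log_zero, zero_div]; linarith
    · have hbpos : 0 < |(b n : ℝ)| := abs_pos.2 (by exact_mod_cast hb0)
      have hsabs : |(s n : ℝ)| = 2 * bigD n * |(b n : ℝ)| := by
        simp only [hs_def]; push_cast
        rw [abs_neg, abs_mul, abs_mul, abs_of_pos (by norm_num : (0 : ℝ) < 2),
          abs_of_pos (by linarith [hD1 n] : (0 : ℝ) < bigD n)]
      rw [hsabs, Real.log_mul (by linarith [hD1 n] : (0 : ℝ) < 2 * bigD n).ne' hbpos.ne',
        Real.log_mul (by norm_num) (by linarith [hD1 n] : (0 : ℝ) < bigD n).ne',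
        add_div, add_div]
      linarith
  -- Lemma 4.3 of [4]
  have h := RhinViola1996.lemma43 (α := zetaValue 3) (R := c₀ - c₂) (S := c₁ + c₂) (by linarith) hS r s herr hs
  have hne : c₀ - c₂ ≠ 0 := by linarith
  have heq : (c₁ + c₂) / (c₀ - c₂) + 1 = (c₀ + c₁) / (c₀ - c₂) := by
    field_simp
    ring
  rw [heq] at h
  exact h

/-- **Theorem 5.1 in the `LiouvilleWith` vocabulary** of the tree's record statement
`zetaThree_irrationalityExponent_lt`: under the hypotheses of `theorem51`, `ζ(3)` is not `p`-Liouville for any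
`p > (c₀ + c₁)/(c₀ − c₂)`. [cite: RhinViola2001, Theorem 5.1 (p. 292)] -/
theorem theorem51_not_liouvilleWith {c₀ c₁ c₂ : ℝ} (a : ℕ → ℚ) (b : ℕ → ℤ)
    (hab : ∀ n : ℕ, 1 ≤ n → I (rvChoice.scale n) = a n + 2 * b n * zetaValue 3)
    (h514 : Tendsto (fun n : ℕ => Real.log (bigD n) / n) atTop (𝓝 c₂))
    (h518 : Tendsto (fun n : ℕ => Real.log (I (rvChoice.scale n)) / n) atTop (𝓝 (-c₀)))
    (h519 : ∀ δ : ℝ, 0 < δ → ∀ᶠ n : ℕ in atTop, Real.log |(b n : ℝ)| / n ≤ c₁ + δ)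
    (hS : 0 < c₁ + c₂) (hc : c₂ < c₀) {p : ℝ} (hp : (c₀ + c₁) / (c₀ - c₂) < p) :
    ¬ LiouvilleWith p (zetaValue 3) :=
  (theorem51 a b hab h514 h518 h519 hS hc).not_liouvilleWith hp

/-- The printed numbers: with `c₀ = 47.15472079`, `c₁ = 48.46940964`, `c₂ = 29.81231469` (p. 293, truncations of the
printed decimals) one has `c₀ > c₂`, `c₁ + c₂ > 0` and `(c₀ + c₁)/(c₀ − c₂) < 5.513891` — "Thus Theorem 5.1 yields
`μ(ζ(3)) < 5.513891`" (checked on the printed decimals only; cf. `rvChoice`'s `record_quotient_lt`).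
[cite: RhinViola2001, §5 p. 293] -/
theorem theorem51_printed_constants :
    (29.81231469 : ℝ) < 47.15472079 ∧ (0 : ℝ) < 48.46940964 + 29.81231469 ∧
      ((47.15472079 : ℝ) + 48.46940964) / (47.15472079 - 29.81231469) < 5.513891 := by
  refine ⟨by norm_num, by norm_num, ?_⟩
  rw [div_lt_iff₀ (by norm_num)]; norm_num

end Section5

end Literature.NumberTheory.Irrationality.RhinViola2001

end
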